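import Literature.Probability.LatticeModels.IsingSAWBoundGraph
import Literature.Combinatorics.SimpleGraph.PathWeightedCountMaxDegree
import HarnessLib

/-!
# Exponential decay of Ising correlations on a bounded-degree graph for `(Δ−1) tanh β < 1` (Fisher's `tanh β_c ≥ 1/(q−1)`)

Topic `Literature/Probability/LatticeModels`. Theorem-only file (no definition, no named fact, no sorry).
Fisher's inequality on an arbitrary finite graph (`isingTwoPoint_free_le_pathSum`, `IsingSAWBoundGraph.lean`) and
the weighted count of self-avoiding paths on a graph with degrees `≤ Δ` (`sum_paths_pow_le`,
`Combinatorics/SimpleGraph/PathWeightedCountMaxDegree.lean`) give, for the nearest-neighbour Ising model with free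
boundary condition and zero field in any finite volume `Λ` of a locally finite graph with degrees `≤ Δ`, `β ≥ 0`,
`r = (Δ−1) tanh β < 1`, and any `1`-Lipschitz height `ℓ` with `ℓ z = 0`:

* `isingTwoPoint_free_le_pathRate` — **`⟨σ_aσ_z⟩^∅_{Λ;β} ≤ Δ tanh β · r^{ℓ(a) − 1} / (1 − r)`** for `a ≠ z` in `Λ`
  (M. E. Fisher, Phys. Rev. 162 (1967) 480: `tanh(J/kT_c) ≥ 1/μ ≥ 1/(q − 1)` for coordination number `q`, here
  with the explicit rate on every bounded-degree graph, uniformly in the volume).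

References: M. E. Fisher, Phys. Rev. 162 (1967) 480 [Fisher1967]; N. Madras, G. Slade, *The Self-Avoiding Walk*
(1993), §1.2 [MadrasSlade1993].
-/

noncomputable section

open Finset

namespace Literature.Probability.LatticeModels

variable {V : Type*} [DecidableEq V] (G : SimpleGraph V) [G.LocallyFinite]

/-- **Fisher's bound with explicit rate on a bounded-degree graph**: degrees `≤ Δ`, `β ≥ 0`,
`r = (Δ−1) tanh β < 1`, `ℓ` `1`-Lipschitz along edges with `ℓ z = 0`; then for `a ≠ z` in the finite volume `Λ`,
`⟨σ_aσ_z⟩^∅_{Λ;β} ≤ Δ tanh β · r^{ℓ a − 1} / (1 − r)`. [cite: Fisher1967, Phys. Rev. 162 (1967) 480 (tanh(J/kT_c) ≥ 1/(q−1))] -/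
theorem isingTwoPoint_free_le_pathRate {Δ : ℕ} (hΔ : ∀ x, (G.neighborFinset x).card ≤ Δ) {β : ℝ} (hβ : 0 ≤ β)
    (hr : ((Δ : ℝ) - 1) * Real.tanh β < 1) (ℓ : V → ℕ) {z : V} (hz : ℓ z = 0)
    (hℓ : ∀ x y, G.Adj x y → ℓ x ≤ ℓ y + 1) {Λ : Finset V} {a : V} (ha : a ∈ Λ) (hzΛ : z ∈ Λ) (haz : a ≠ z) :
    isingTwoPoint G Λ β 0 .free a z ≤
      (Δ : ℝ) * Real.tanh β * (((Δ : ℝ) - 1) * Real.tanh β) ^ (ℓ a - 1) / (1 - ((Δ : ℝ) - 1) * Real.tanh β) := by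
  classical
  have ht0 : 0 ≤ Real.tanh β := by
    rw [Real.tanh_eq_sinh_div_cosh]; exact div_nonneg (Real.sinh_nonneg_iff.2 hβ) (Real.cosh_pos β).le
  exact (isingTwoPoint_free_le_pathSum G hβ ha hzΛ haz).trans
    (Literature.Combinatorics.SimpleGraph.sum_paths_pow_le G hΔ ht0 hr ℓ hz hℓ _ haz)

/-- The same with a uniform exponent: for `Δ ≥ 2`, `⟨σ_aσ_z⟩^∅_{Λ;β} ≤ (Δ/(Δ−1)) · r^{ℓ a} / (1 − r)` (also for `a = z`,
where the right-hand side is `≥ 1`). [cite: Fisher1967, Phys. Rev. 162 (1967) 480 (tanh(J/kT_c) ≥ 1/(q−1))] -/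
theorem isingTwoPoint_free_le_pathRate' {Δ : ℕ} (hΔ2 : 2 ≤ Δ) (hΔ : ∀ x, (G.neighborFinset x).card ≤ Δ) {β : ℝ}
    (hβ : 0 ≤ β) (hr : ((Δ : ℝ) - 1) * Real.tanh β < 1) (ℓ : V → ℕ) {z : V} (hz : ℓ z = 0)
    (hℓ : ∀ x y, G.Adj x y → ℓ x ≤ ℓ y + 1) {Λ : Finset V} {a : V} (ha : a ∈ Λ) (hzΛ : z ∈ Λ) :
    isingTwoPoint G Λ β 0 .free a z ≤
      (Δ : ℝ) / ((Δ : ℝ) - 1) * (((Δ : ℝ) - 1) * Real.tanh β) ^ ℓ a / (1 - ((Δ : ℝ) - 1) * Real.tanh β) := by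
  classical
  have ht0 : 0 ≤ Real.tanh β := by
    rw [Real.tanh_eq_sinh_div_cosh]; exact div_nonneg (Real.sinh_nonneg_iff.2 hβ) (Real.cosh_pos β).le
  have hΔ1 : (1 : ℝ) < Δ := by exact_mod_cast hΔ2
  set r := ((Δ : ℝ) - 1) * Real.tanh β with hrdef
  have hr0 : 0 ≤ r := by rw [hrdef]; nlinarith
  have h1r : 0 < 1 - r := by linarith
  by_cases haz : a = z
  · subst haz
    rw [hz, pow_zero, mul_one, isingTwoPoint_self, le_div_iff₀ h1r, one_mul, le_div_iff₀ (by linarith)]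
    nlinarith
  · refine (isingTwoPoint_free_le_pathRate G hΔ hβ hr ℓ hz hℓ ha hzΛ haz).trans ?_
    refine div_le_div_of_nonneg_right ?_ h1r.le
    rcases Nat.eq_zero_or_pos (ℓ a) with h0 | hpos
    · -- `ℓ a = 0`: `Δ t ≤ Δ/(Δ−1)` since `r = (Δ−1) t < 1`
      have e : r ^ (ℓ a - 1) = 1 := by rw [h0]; norm_num
      rw [e, h0, pow_zero, mul_one, mul_one, le_div_iff₀ (by linarith)]
      nlinarith
    · have hne : (Δ : ℝ) - 1 ≠ 0 := by linarith
      have : (Δ : ℝ) * Real.tanh β * r ^ (ℓ a - 1) = (Δ : ℝ) / ((Δ : ℝ) - 1) * (r * r ^ (ℓ a - 1)) := by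
        rw [hrdef]; field_simp
      rw [this, ← pow_succ', Nat.sub_add_cancel hpos]

end Literature.Probability.LatticeModels

end
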